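import Summits.QuantumAdvantage.QuantumAdvantage.Theorems.CubicForrelationNearExactIsExactTwelveLevelSixPrep

/-!
# Crux `CubicForrelation.NearExactIsExact` (stmt-QuantumAdvantage-14043) — n = 12, level ≥ 6 in the whole window top `(59/64, 1)`: the
  CROSS-COSET localisation and the tolerant (H3)/(H4)

Certificate seat `b2b-cforr-cert` (gen 13).  HONEST FRAMING: lemmas (standard axioms) for `tw6_levelSix_lt` (`…TwelveLevelSixWindowAll.lean`);
finite-slice bookkeeping about cubic Boolean pairs on 12 bits, NOT summit progress.

Setting as in `…TwelveLevelSixPrep.lean`: cubic `f, g`, `W_g = 64u''`, `Z = {u'' even} = x_Z ⊕ V₀` a 9-flat, `e = u'' − (−1)^f`.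
* `tw6_cross_coset`: if `e ≡ 0 (mod 4)` off `Z ∪ (y ⊕ V₀)` for some `y ∉ Z`, then for all `a, b, c ∈ V₀` the 3-flat sums based at `x_Z`
  and at `y` satisfy `Σ_{x_Z⊕⟨a,b,c⟩} e + Σ_{y⊕⟨a,b,c⟩} e ≡ 0 (mod 4)`.  Proof: with `w = x_Z ⊕ y` (`∉ V₀`) and two further directions
  `t₂, t₃` transversal to `V₀`, to `w ⊕ V₀` and to each other (`fl1_avoid`), the 6-flat `x_Z ⊕ ⟨t₂, t₃, w, a, b, c⟩` has sum `≡ 0 (mod 4)`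
  (`fs_flat_sum_dvd` + Ax); the truncation `e·1_{Z ∪ (Z⊕w)}` differs from `e` by multiples of `4` and vanishes at the `t₂, t₃, t₂t₃`
  translates of the inner 4-flat `x_Z ⊕ ⟨w, a, b, c⟩` (`sp_loc2`), which splits into the two 3-flats (`fr_sum_peel`).
* `tw6_H34_tol`: (H3) `4 ∣ Σ_{3-flat ⊂ Z} e` and (H4) `8 ∣ Σ_{4-flat ⊂ Z} e` hold as soon as `8 ∣ e` off `Z` (not only when `e = 0` off `Z`,
  `tw6_H34`): the off-`Z` values contribute multiples of `32` to the 6- and 7-flat sums of `u − 4s = 4e`.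

References: J. Ax (1964) / R. J. McEliece (1972); MacWilliams–Sloane (1977) Ch. 13 §3.  Everything below is proved from Mathlib and the
tree; axioms are the standard three.
-/

set_option linter.dupNamespace false -- D-0017: single-problem summit ⇒ `QuantumAdvantage.QuantumAdvantage` by design

noncomputable section

namespace Summit.QuantumAdvantage.QuantumAdvantage.Theorems.CubicForrelation.NearExactIsExact

open Finset
open Literature.Computability.QuantumComplexity
open Literature.Computability.QuantumComplexity.BuzetChailloux (bxor zeroVec bxor_bxor_cancel_left bxor_zeroVec zeroVec_bxor bxor_comm
  bxor_self)
open Literature.Computability.QuantumComplexity.DerivativeWalsh (W)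

/-! ### The cross-coset localisation -/

/-- **Cross-coset localisation.**  Cubic `f, g` on 12 bits, `W_g = 64u''`, `Z = {u'' even} = x_Z ⊕ V₀` (`V₀ ∋ 0` xor-closed, `2⁹`
elements), `y ∉ Z`, and `4 ∣ e` at every point outside `Z` and outside the coset `y ⊕ V₀` (`e = u'' − (−1)^f`).  Then for all
`a, b, c ∈ V₀`: `4 ∣ Σ_{ε} e(x_Z ⊕ ε·(a,b,c)) + Σ_{ε} e(y ⊕ ε·(a,b,c))`. [this work] -/
theorem tw6_cross_coset (f g : (Fin (6 + 6) → Bool) → Bool) (hf : IsDegLeFun 3 f) (hg : IsDegLeFun 3 g)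
    (u'' : (Fin (6 + 6) → Bool) → ℤ) (hu'' : ∀ x, W (fun y => signOf (g y)) x = (2 : ℝ) ^ 6 * (u'' x : ℝ))
    (V₀ : Finset (Fin (6 + 6) → Bool)) (xZ : Fin (6 + 6) → Bool) (h0 : zeroVec ∈ V₀)
    (hadd : ∀ a ∈ V₀, ∀ b ∈ V₀, bxor a b ∈ V₀) (hcardV9 : #V₀ = 2 ^ 9)
    (hS : (univ.filter fun x : Fin (6 + 6) → Bool => ¬ Odd (u'' x)) = V₀.image (bxor xZ))
    (y : Fin (6 + 6) → Bool) (hyZ : y ∉ (univ.filter fun x : Fin (6 + 6) → Bool => ¬ Odd (u'' x)))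
    (hout4 : ∀ z, z ∉ (univ.filter fun x : Fin (6 + 6) → Bool => ¬ Odd (u'' x)) →
      bxor z (bxor xZ y) ∉ (univ.filter fun x : Fin (6 + 6) → Bool => ¬ Odd (u'' x)) → (4 : ℤ) ∣ u'' z - sZ (f z))
    {a b c : Fin (6 + 6) → Bool} (ha : a ∈ V₀) (hb : b ∈ V₀) (hc : c ∈ V₀) :
    (4 : ℤ) ∣ ∑ ε : Fin 3 → Bool, (u'' (fun j => xZ j ^^ decide (Odd #(univ.filter fun i =>
        ε i && (![a, b, c] : Fin 3 → Fin (6 + 6) → Bool) i j))) - sZ (f (fun j => xZ j ^^ decide (Odd #(univ.filter fun i =>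
        ε i && (![a, b, c] : Fin 3 → Fin (6 + 6) → Bool) i j))))) +
      ∑ ε : Fin 3 → Bool, (u'' (fun j => y j ^^ decide (Odd #(univ.filter fun i =>
        ε i && (![a, b, c] : Fin 3 → Fin (6 + 6) → Bool) i j))) - sZ (f (fun j => y j ^^ decide (Odd #(univ.filter fun i =>
        ε i && (![a, b, c] : Fin 3 → Fin (6 + 6) → Bool) i j))))) := by
  classical
  set Z := univ.filter (fun x : Fin (6 + 6) → Bool => ¬ Odd (u'' x)) with hZdef
  set u : (Fin (6 + 6) → Bool) → ℤ := fun x => 4 * u'' x with hudef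
  have hu : ∀ x, W (fun y => signOf (g y)) x = (2 : ℝ) ^ 4 * (u x : ℝ) := by
    intro x; rw [hu'' x]; simp only [u]; push_cast; ring
  set e : (Fin (6 + 6) → Bool) → ℤ := fun x => u'' x - sZ (f x) with hedef
  show (4 : ℤ) ∣ ∑ ε : Fin 3 → Bool, e (fun j => xZ j ^^ decide (Odd #(univ.filter fun i =>
        ε i && (![a, b, c] : Fin 3 → Fin (6 + 6) → Bool) i j))) +
      ∑ ε : Fin 3 → Bool, e (fun j => y j ^^ decide (Odd #(univ.filter fun i =>
        ε i && (![a, b, c] : Fin 3 → Fin (6 + 6) → Bool) i j)))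
  have hFe : ∀ z, u z - 4 * sZ (f z) = 4 * e z := fun z => by simp only [u, e]; ring
  have hxZ : xZ ∈ Z := by rw [hS]; exact mem_image.2 ⟨zeroVec, h0, bxor_zeroVec xZ⟩
  have hPV : ∀ x, x ∈ Z → ∀ a ∈ V₀, bxor x a ∈ Z := fun x hx a ha => fl1_coset_vadd hadd hS hx ha
  have hZw : ∀ q, q ∈ Z → ∀ δ, (bxor q δ ∈ Z ↔ δ ∈ V₀) := by
    intro q hq δ
    have h := fl_coset_translate V₀ Z xZ hadd hS hq h0 δ
    rwa [bxor_zeroVec] at h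
  -- `w = x_Z ⊕ y ∉ V₀`
  set w : Fin (6 + 6) → Bool := bxor xZ y with hw
  have hyw : y = bxor xZ w := by rw [hw, bxor_bxor_cancel_left]
  have hwV : w ∉ V₀ := fun hwV => hyZ (by rw [hyw]; exact hPV _ hxZ _ hwV)
  have hNcard : #(univ : Finset (Fin (6 + 6) → Bool)) = 4096 := by
    rw [card_univ, Fintype.card_fun, Fintype.card_bool, Fintype.card_fin]; norm_num
  -- two more directions
  obtain ⟨t₂, -, ht₂⟩ := fl1_avoid univ V₀ [zeroVec, w] (by
    simp only [List.length_cons, List.length_nil]; rw [hcardV9, hNcard]; norm_num)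
  have e₂ : t₂ ∉ V₀ := by simpa only [zeroVec_bxor] using ht₂ zeroVec (by simp)
  have e₂w : bxor w t₂ ∉ V₀ := ht₂ w (by simp)
  obtain ⟨t₃, -, ht₃⟩ := fl1_avoid univ V₀ [zeroVec, w, t₂, bxor w t₂] (by
    simp only [List.length_cons, List.length_nil]; rw [hcardV9, hNcard]; norm_num)
  have e₃ : t₃ ∉ V₀ := by simpa only [zeroVec_bxor] using ht₃ zeroVec (by simp)
  have e₃w : bxor w t₃ ∉ V₀ := ht₃ w (by simp)
  have e₃₂ : bxor t₂ t₃ ∉ V₀ := ht₃ t₂ (by simp)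
  have e₃₂w : bxor (bxor w t₂) t₃ ∉ V₀ := ht₃ (bxor w t₂) (by simp)
  -- the truncated residual
  set e₁ : (Fin (6 + 6) → Bool) → ℤ := fun z => if z ∈ Z ∨ bxor z w ∈ Z then e z else 0 with he₁
  have hdiff : ∀ z, (4 : ℤ) ∣ e z - e₁ z := by
    intro z
    by_cases h : z ∈ Z ∨ bxor z w ∈ Z
    · simp only [e₁, if_pos h, sub_self]; exact dvd_zero _
    · have h' := not_or.1 h
      simp only [e₁, if_neg h, sub_zero]
      exact hout4 z h'.1 h'.2
  -- the 6-flat sum of `e`, hence of `e₁`, is `≡ 0 (mod 4)`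
  have h6 : (4 : ℤ) ∣ ∑ ε : Fin 6 → Bool, e (fun j => xZ j ^^ decide (Odd #(univ.filter fun i =>
      ε i && (Matrix.vecCons t₂ (Matrix.vecCons t₃ (Matrix.vecCons w ![a, b, c])) : Fin 6 → Fin (6 + 6) → Bool) i j))) := by
    have h1 := fs_flat_sum_dvd (e := 4) g u hg hu xZ (Matrix.vecCons t₂ (Matrix.vecCons t₃ (Matrix.vecCons w ![a, b, c]))) (by norm_num)
    obtain ⟨zf, hzf⟩ := sl_sum_sZ_flat f hf xZ (Matrix.vecCons t₂ (Matrix.vecCons t₃ (Matrix.vecCons w ![a, b, c])))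
    have hzf' : ∑ ε : Fin 6 → Bool, 4 * sZ (f (fun j => xZ j ^^ decide (Odd #(univ.filter fun i =>
        ε i && (Matrix.vecCons t₂ (Matrix.vecCons t₃ (Matrix.vecCons w ![a, b, c])) : Fin 6 → Fin (6 + 6) → Bool) i j)))) = 16 * zf := by
      rw [← mul_sum, hzf]; norm_num; ring
    have h1' : (16 : ℤ) ∣ ∑ ε : Fin 6 → Bool, u (fun j => xZ j ^^ decide (Odd #(univ.filter fun i =>
        ε i && (Matrix.vecCons t₂ (Matrix.vecCons t₃ (Matrix.vecCons w ![a, b, c])) : Fin 6 → Fin (6 + 6) → Bool) i j))) := by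
      have e16 : (2 : ℤ) ^ 4 = 16 := by norm_num
      rw [e16] at h1; exact h1
    have h2 : (16 : ℤ) ∣ ∑ ε : Fin 6 → Bool, (u (fun j => xZ j ^^ decide (Odd #(univ.filter fun i =>
        ε i && (Matrix.vecCons t₂ (Matrix.vecCons t₃ (Matrix.vecCons w ![a, b, c])) : Fin 6 → Fin (6 + 6) → Bool) i j))) -
        4 * sZ (f (fun j => xZ j ^^ decide (Odd #(univ.filter fun i =>
        ε i && (Matrix.vecCons t₂ (Matrix.vecCons t₃ (Matrix.vecCons w ![a, b, c])) : Fin 6 → Fin (6 + 6) → Bool) i j))))) := by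
      rw [sum_sub_distrib, hzf']; exact dvd_sub h1' (Dvd.intro _ rfl)
    have h3 : ∑ ε : Fin 6 → Bool, (u (fun j => xZ j ^^ decide (Odd #(univ.filter fun i =>
        ε i && (Matrix.vecCons t₂ (Matrix.vecCons t₃ (Matrix.vecCons w ![a, b, c])) : Fin 6 → Fin (6 + 6) → Bool) i j))) -
        4 * sZ (f (fun j => xZ j ^^ decide (Odd #(univ.filter fun i =>
        ε i && (Matrix.vecCons t₂ (Matrix.vecCons t₃ (Matrix.vecCons w ![a, b, c])) : Fin 6 → Fin (6 + 6) → Bool) i j))))) =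
        4 * ∑ ε : Fin 6 → Bool, e (fun j => xZ j ^^ decide (Odd #(univ.filter fun i =>
        ε i && (Matrix.vecCons t₂ (Matrix.vecCons t₃ (Matrix.vecCons w ![a, b, c])) : Fin 6 → Fin (6 + 6) → Bool) i j))) := by
      rw [mul_sum]; exact sum_congr rfl fun ε _ => hFe _
    rw [h3] at h2
    obtain ⟨k, hk⟩ := h2
    exact ⟨k, by linarith⟩
  have h6' : (4 : ℤ) ∣ ∑ ε : Fin 6 → Bool, e₁ (fun j => xZ j ^^ decide (Odd #(univ.filter fun i =>
      ε i && (Matrix.vecCons t₂ (Matrix.vecCons t₃ (Matrix.vecCons w ![a, b, c])) : Fin 6 → Fin (6 + 6) → Bool) i j))) := by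
    have hd : (4 : ℤ) ∣ ∑ ε : Fin 6 → Bool, (e (fun j => xZ j ^^ decide (Odd #(univ.filter fun i =>
        ε i && (Matrix.vecCons t₂ (Matrix.vecCons t₃ (Matrix.vecCons w ![a, b, c])) : Fin 6 → Fin (6 + 6) → Bool) i j))) -
        e₁ (fun j => xZ j ^^ decide (Odd #(univ.filter fun i =>
        ε i && (Matrix.vecCons t₂ (Matrix.vecCons t₃ (Matrix.vecCons w ![a, b, c])) : Fin 6 → Fin (6 + 6) → Bool) i j)))) :=
      dvd_sum fun ε _ => hdiff _
    rw [sum_sub_distrib] at hd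
    have := dvd_sub h6 hd
    simpa using this
  -- the inner 4-flat `x_Z ⊕ ⟨w, a, b, c⟩` lies in `Z ∪ (Z ⊕ w)`
  have hinZ : ∀ ε : Fin 3 → Bool, (fun j => xZ j ^^ decide (Odd #(univ.filter fun i =>
      ε i && (![a, b, c] : Fin 3 → Fin (6 + 6) → Bool) i j))) ∈ Z :=
    fun ε => fr_mem_flatPt3 V₀ h0 (· ∈ Z) hPV hxZ ![a, b, c] (fun i => by fin_cases i <;> assumption) ε
  have hq : ∀ ε : Fin (3 + 1) → Bool, (fun j => xZ j ^^ decide (Odd #(univ.filter fun i =>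
      ε i && (Matrix.vecCons w ![a, b, c] : Fin (3 + 1) → Fin (6 + 6) → Bool) i j))) ∈ Z ∨
      bxor (fun j => xZ j ^^ decide (Odd #(univ.filter fun i =>
      ε i && (Matrix.vecCons w ![a, b, c] : Fin (3 + 1) → Fin (6 + 6) → Bool) i j))) w ∈ Z := by
    intro ε
    have e1 : ε = Fin.cons (ε 0) (Fin.tail ε) := (Fin.cons_self_tail ε).symm
    rw [e1]
    show (fun j => xZ j ^^ decide (Odd #(univ.filter fun i : Fin (3 + 1) =>
        (Fin.cons (ε 0) (Fin.tail ε) : Fin (3 + 1) → Bool) i && (Fin.cons w ![a, b, c] : Fin (3 + 1) → Fin (6 + 6) → Bool) i j))) ∈ Z ∨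
      bxor (fun j => xZ j ^^ decide (Odd #(univ.filter fun i : Fin (3 + 1) =>
        (Fin.cons (ε 0) (Fin.tail ε) : Fin (3 + 1) → Bool) i && (Fin.cons w ![a, b, c] : Fin (3 + 1) → Fin (6 + 6) → Bool) i j))) w ∈ Z
    rw [erm_flatPt_cons]
    cases ε 0
    · left; simp only [Bool.false_and, Bool.xor_false]; exact hinZ _
    · right
      simp only [Bool.true_and]
      have : bxor (fun j => (xZ j ^^ decide (Odd #(univ.filter fun i => (Fin.tail ε) i && (![a, b, c] : Fin 3 → Fin (6 + 6) → Bool) i j))) ^^ w j) w =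
          (fun j => xZ j ^^ decide (Odd #(univ.filter fun i => (Fin.tail ε) i && (![a, b, c] : Fin 3 → Fin (6 + 6) → Bool) i j))) := by
        funext j; simp only [bxor]; cases w j <;> simp
      rw [this]; exact hinZ _
  -- vanishing of `e₁` at the transversal translates
  have hvan : ∀ (q δ : Fin (6 + 6) → Bool), (q ∈ Z ∨ bxor q w ∈ Z) → δ ∉ V₀ → bxor w δ ∉ V₀ → e₁ (bxor q δ) = 0 := by
    intro q δ hq' hδ hwδ
    have hnot : ¬ (bxor q δ ∈ Z ∨ bxor (bxor q δ) w ∈ Z) := by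
      rintro (h | h)
      · rcases hq' with hq | hq
        · exact hδ ((hZw q hq δ).1 h)
        · have e2 : bxor q δ = bxor (bxor q w) (bxor w δ) := by
            rw [iw_bxor_assoc, ← iw_bxor_assoc w w δ, bxor_self, zeroVec_bxor]
          rw [e2] at h
          exact hwδ ((hZw _ hq _).1 h)
      · rcases hq' with hq | hq
        · have e2 : bxor (bxor q δ) w = bxor q (bxor w δ) := by rw [iw_bxor_assoc, bxor_comm δ w]
          rw [e2] at h
          exact hwδ ((hZw q hq _).1 h)
        · have e2 : bxor (bxor q δ) w = bxor (bxor q w) δ := by rw [iw_bxor_assoc, bxor_comm δ w, ← iw_bxor_assoc]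
          rw [e2] at h
          exact hδ ((hZw _ hq δ).1 h)
    simp only [e₁, if_neg hnot]
  have hloc := sp_loc2 e₁ xZ t₂ t₃ (Matrix.vecCons w ![a, b, c])
    (fun ε => hvan _ _ (hq ε) e₂ e₂w) (fun ε => hvan _ _ (hq ε) e₃ e₃w)
    (fun ε => by
      rw [iw_bxor_assoc]
      refine hvan _ _ (hq ε) ?_ ?_
      · rw [bxor_comm]; exact e₃₂
      · have e2 : bxor w (bxor t₃ t₂) = bxor (bxor w t₂) t₃ := by
          funext j; show (w j ^^ (t₃ j ^^ t₂ j)) = ((w j ^^ t₂ j) ^^ t₃ j); cases w j <;> cases t₂ j <;> cases t₃ j <;> rfl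
        rw [e2]; exact e₃₂w)
  rw [hloc] at h6'
  -- split the inner 4-flat by the parameter of `w`
  have p1 := fr_sum_peel e₁ xZ w ![a, b, c]
  rw [p1] at h6'
  have hA : ∀ ε : Fin 3 → Bool, e₁ (fun j => xZ j ^^ decide (Odd #(univ.filter fun i =>
      ε i && (![a, b, c] : Fin 3 → Fin (6 + 6) → Bool) i j))) =
      e (fun j => xZ j ^^ decide (Odd #(univ.filter fun i => ε i && (![a, b, c] : Fin 3 → Fin (6 + 6) → Bool) i j))) := by
    intro ε; simp only [e₁, if_pos (Or.inl (hinZ ε))]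
  have hB : ∀ ε : Fin 3 → Bool, e₁ (bxor (fun j => xZ j ^^ decide (Odd #(univ.filter fun i =>
      ε i && (![a, b, c] : Fin 3 → Fin (6 + 6) → Bool) i j))) w) =
      e (fun j => y j ^^ decide (Odd #(univ.filter fun i => ε i && (![a, b, c] : Fin 3 → Fin (6 + 6) → Bool) i j))) := by
    intro ε
    have hmem : bxor (bxor (fun j => xZ j ^^ decide (Odd #(univ.filter fun i =>
        ε i && (![a, b, c] : Fin 3 → Fin (6 + 6) → Bool) i j))) w) w ∈ Z := by
      rw [iw_bxor_assoc, bxor_self, bxor_zeroVec]; exact hinZ ε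
    simp only [e₁, if_pos (Or.inr hmem)]
    congr 1
    funext j; simp only [bxor, hyw]; cases xZ j <;> cases w j <;> simp
  rw [sum_congr rfl fun ε _ => hA ε, sum_congr rfl fun ε _ => hB ε] at h6'
  exact h6'

end Summit.QuantumAdvantage.QuantumAdvantage.Theorems.CubicForrelation.NearExactIsExact

end
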